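import Mathlib.RingTheory.MvPolynomial.Homogeneous
import Mathlib.RingTheory.MvPolynomial.Ideal
import Mathlib.Algebra.MvPolynomial.Supported
import Mathlib.Data.Fin.VecNotation
import Summits.ResolutionOfSingularities.ResolutionOfSingularities.Theorems.MarkedTransferCampaignW31QuinticEdgeData
import HarnessLib

/-!
# Kill test K3.1 (LADDER-RESOLUTION rung L, slot W3.1) — ADDENDUM: the hand steps behind the upper bounds `G(Q) ⊆ K[x̄, ȳ]`,
# `G(O) ⊆ K[ȳ]` of the specimen `Ê = (y² − x²z² + x⁵, 2)` as GENERAL polynomial lemmas (every exponent `q`, every polynomial)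

Cell `res-hironaka`, seat `res-L1-k31` (gen 3); companion of `MarkedTransferCampaignW31QuinticEdgeData.lean` (p463820) and of the report
`L/res-L1-k31/KILL-TEST-K3.1.md`, whose §3.2 steps (5)–(6) were so far HAND steps backed by kernel identities for ONE candidate family of
initial forms (`QuinticEdgeData.chartX_candidate`, `eval_candidate_exceptionalPoint`, `eq_zero_of_forall_pow_eq_zero`: the family
`(αx̄ + γz̄)^q + βȳ^q`) and by CAS rows for `q ≤ 4` (kit job j258736). HONEST FRAMING: «[OURS · L1 W3.1] kill-test helper; NOT a statement
of the manuscript.» Everything below is elementary algebra in `K[x, y, z] = MvPolynomial (Fin 3) K` over an ARBITRARY commutative ring `K`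
(`x = X 0`, `y = X 1`, `z = X 2`); NOTHING here asserts a statement of H. Hironaka's manuscript (2017-03-23, [claim: Hironaka2017,
status: under-review]). What remains a hand step after this file (report §8): only «geometric `℘` ⇒ permissibility is inherited by
`(h, q)` along the two test blow-ups» and «order `≥ q` along a smooth centre of a regular scheme ⇒ membership in the `q`-th power of its
ideal» — both over the manuscript's DEFINITION of `℘` (p.17 l.1–3), not over any of its claims.

Contents.
* §1 exponent bookkeeping on `Fin 3`.
* §2 **(E5) AXIS LEMMA** (report §3.2 step 5, general axis point `Q`): `h ∈ (x, y)^q` (`QuinticEdgeData.axisIdeal ^ q`) ⇒ every monomial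
  of `h` has `x`-exponent + `y`-exponent `≥ q` (`le_of_mem_axisIdeal_pow`) ⇒ the degree-`q` homogeneous component of `h` (its initial form
  in degree `q`) lies in `K[x, y] = Algebra.adjoin K {x, y}` (`homogeneousComponent_mem_adjoin_of_mem_axisIdeal_pow`), the carrier of
  `QuinticEdgeAlgebras.toEdgeInv_adjoin_axis` (the translation `QuinticEdgeData.shiftQ c` moving `Q = (0,0,c)` to `O` fixes `(x, y)`).
* §3 the `x`-CHART IDENTITY: for `F` homogeneous of degree `q`, `QuinticEdgeData.chartX F = x^q · F(1, y′, z′)` (`chartX_eq_X_pow_mul_dehom`;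
  `F(1, y′, z′) = aeval ![1, X 1, X 2] F` is the controlled transform of the initial form restricted to the exceptional divisor `{x = 0}`),
  and the coefficients of `F(1, y′, z′)` (`coeff_dehom_of_isHomogeneous`: distinct monomials of `F` stay distinct).
* §4 **(E6) ESCAPE LEMMA, line form** (report §3.2 step 6, origin `O`): `F` homogeneous of degree `q` with `F(1, y′, z′) ∈ (y′^q)` — what
  permissibility of the whole exceptional LINE `{x = y′ = 0}` (a line of order-`2` points of the transform, `QuinticEdgeData.f₁X_mem_sq`)
  imposes on the transform of a member `(h, q) ∈ ℘(Ê, q)_O` with `in_O h = F` — forces `F = c · y^q` (`eq_C_mul_X_pow_of_dehom_mem_span`),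
  so `F ∈ K[ȳ] = Algebra.adjoin K {y}` (`mem_adjoin_origin_of_dehom_mem_span`), the carrier of `QuinticEdgeAlgebras.toEdgeInv_adjoin_origin`;
  `y^q` itself passes (`dehom_X_pow_mem_span`).
* §5 **(E6′) ESCAPE LEMMA, pointwise form** (the PRE-REGISTERED, CAS-checked variant): order `≥ q` of `F(1, y′, z′)` at the TWO exceptional
  points `(0,0,0)` and `(0,0,1)` already forces `F = c · y^q` (`eq_C_mul_X_pow_of_order_at_two_points`).
Both forms supersede p463820 §4 for ALL initial forms, all `q`, all commutative `K`.

Host item: MarkedTransfer `HypersurfaceOrderReduction` (stmt-ResolutionOfSingularities-16155), as for p461082 / p463820. No new route, no new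
item, no definition.

## References
* H. Hironaka, ms. 2017-03-23 [Hironaka2017]: p.17 l.1–3 (geometric `℘`), Def. 2.1 p.5 (transform), Def. 4.6 / 4.9 pp.19–20 — locators only.
  Cell files `L/res-L1-k31/KILL-TEST-K3.1.md` §3.2, §8.
-/

set_option linter.dupNamespace false -- mandated namespace of this single-conjunct summit

noncomputable section

namespace Summit.ResolutionOfSingularities.ResolutionOfSingularities.Theorems.QuinticEscapeLemma

open MvPolynomial

variable {K : Type*} [CommRing K]

/-! ## §1 Exponent bookkeeping on `Fin 3` -/

/-- A monomial occurring in a homogeneous polynomial of degree `q` has exponent sum `q`. [OURS · L1 W3.1] kill-test helper;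
NOT a statement of the manuscript. -/
theorem sum_eq_of_mem_support {F : MvPolynomial (Fin 3) K} {q : ℕ} (hF : F.IsHomogeneous q)
    {m : Fin 3 →₀ ℕ} (hm : m ∈ F.support) : m 0 + m 1 + m 2 = q := by
  have h := hF.degree_eq_sum_deg_support hm
  rw [← Finsupp.degree_apply, Finsupp.degree_eq_sum, Fin.sum_univ_three] at h
  exact h.symm

/-- Exponent vectors of equal degree with equal `y`-, `z`-exponents are equal. [OURS · L1 W3.1] helper; NOT a manuscript statement. -/
theorem eq_of_tail_eq {m m' : Fin 3 →₀ ℕ} (h1 : m' 1 = m 1) (h2 : m' 2 = m 2)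
    (hdeg : m' 0 + m' 1 + m' 2 = m 0 + m 1 + m 2) : m' = m := by
  ext i; fin_cases i
  · show m' 0 = m 0; omega
  · exact h1
  · exact h2

/-! ## §2 (E5) The axis lemma: `h ∈ (x, y)^q` ⇒ the degree-`q` initial form of `h` lies in `K[x, y]` -/

/-- **(E5, core)** Every monomial of an element of `(x, y)^q ⊆ K[x, y, z]` has `x`-exponent + `y`-exponent `≥ q`.
[OURS · L1 W3.1] kill-test helper; NOT a statement of the manuscript. -/
theorem le_of_mem_axisIdeal_pow (q : ℕ) :
    ∀ h ∈ (QuinticEdgeData.axisIdeal : Ideal (MvPolynomial (Fin 3) K)) ^ q,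
      ∀ m ∈ h.support, q ≤ m 0 + m 1 := by
  classical
  induction q with
  | zero => intro h _ m _; exact Nat.zero_le _
  | succ q ih =>
    intro h hh
    rw [pow_succ] at hh
    refine Submodule.smul_induction_on (p := fun g => ∀ m ∈ g.support, q + 1 ≤ m 0 + m 1) hh ?_ ?_
    · intro a ha b hb m hm
      obtain ⟨m₁, hm₁, m₂, hm₂, rfl⟩ := Finset.mem_add.mp (MvPolynomial.support_mul a b hm)
      have h₁ : q ≤ m₁ 0 + m₁ 1 := ih a ha m₁ hm₁
      have hb' : b ∈ Ideal.span (MvPolynomial.X '' ({0, 1} : Set (Fin 3)) : Set (MvPolynomial (Fin 3) K)) := by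
        rwa [Set.image_insert_eq, Set.image_singleton]
      obtain ⟨i, hi, hi0⟩ := MvPolynomial.mem_ideal_span_X_image.mp hb' m₂ hm₂
      simp only [Set.mem_insert_iff, Set.mem_singleton_iff] at hi
      simp only [Finsupp.coe_add, Pi.add_apply]
      rcases hi with rfl | rfl <;> omega
    · intro a b ha hb m hm
      rcases Finset.mem_union.mp (MvPolynomial.support_add hm) with h | h
      exacts [ha m h, hb m h]

/-- **(E5)** If `h ∈ (x, y)^q` then the degree-`q` homogeneous component of `h` (its initial form in degree `q` at the origin)
involves no `z`: it lies in `K[x, y] = Algebra.adjoin K {x, y} ⊆ K[x, y, z]`, the carrier of the axis point's edge algebra in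
`QuinticEdgeAlgebras.toEdgeInv_adjoin_axis`. Report §3.2 step 5: a member `(h, q)` of `℘(Ê, q)` at a general axis point `Q` has
order `≥ q` along the axis, hence `h ∈ (x, y)^q`, hence contributes to `G(Q)_q` only inside `K[x̄, ȳ]_q`.
[OURS · L1 W3.1] kill-test helper; NOT a statement of the manuscript. -/
theorem homogeneousComponent_mem_adjoin_of_mem_axisIdeal_pow {h : MvPolynomial (Fin 3) K} {q : ℕ}
    (hh : h ∈ (QuinticEdgeData.axisIdeal : Ideal (MvPolynomial (Fin 3) K)) ^ q) :
    homogeneousComponent q h ∈ Algebra.adjoin K ({X 0, X 1} : Set (MvPolynomial (Fin 3) K)) := by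
  classical
  have himg : (MvPolynomial.X '' ({0, 1} : Set (Fin 3)) : Set (MvPolynomial (Fin 3) K)) = {X 0, X 1} := by
    rw [Set.image_insert_eq, Set.image_singleton]
  rw [← himg, ← MvPolynomial.supported_eq_adjoin_X, MvPolynomial.mem_supported]
  intro i hi
  obtain ⟨d, hd, hid⟩ := (MvPolynomial.mem_vars_iff_mem_support i).mp (Finset.mem_coe.mp hi)
  rw [MvPolynomial.support_homogeneousComponent, Finset.mem_filter] at hd
  obtain ⟨hdh, hdeg⟩ := hd
  have h01 : q ≤ d 0 + d 1 := le_of_mem_axisIdeal_pow q h hh d hdh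
  rw [Finsupp.degree_eq_sum, Fin.sum_univ_three] at hdeg
  have hne : d i ≠ 0 := Finsupp.mem_support_iff.mp hid
  simp only [Set.mem_insert_iff, Set.mem_singleton_iff]
  fin_cases i
  exacts [Or.inl rfl, Or.inr rfl, absurd (show d 2 = 0 by omega) hne]

/-! ## §3 The `x`-chart identity and the coefficients of the dehomogenisation `F(1, y′, z′)` -/

/-- Dehomogenisation of a monomial: `(a·x^{m₀} y^{m₁} z^{m₂})(1, y, z) = a·y^{m₁} z^{m₂}`. [OURS · L1 W3.1] kill-test helper;
NOT a statement of the manuscript. -/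
theorem dehom_monomial (m : Fin 3 →₀ ℕ) (a : K) :
    aeval ![(1 : MvPolynomial (Fin 3) K), X 1, X 2] (monomial m a) =
      monomial (Finsupp.single 1 (m 1) + Finsupp.single 2 (m 2)) a := by
  rw [MvPolynomial.aeval_monomial, Finsupp.prod_pow, Fin.prod_univ_three, MvPolynomial.monomial_eq, Finsupp.prod_pow,
    Fin.prod_univ_three]
  simp

/-- The `x`-chart of the blow-up of the origin on a monomial: `x^{m₀} (xy)^{m₁} (xz)^{m₂} = x^{m₀+m₁+m₂} y^{m₁} z^{m₂}`.
[OURS · L1 W3.1] kill-test helper; NOT a statement of the manuscript. -/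
theorem chartX_monomial (m : Fin 3 →₀ ℕ) (a : K) :
    QuinticEdgeData.chartX (monomial m a) =
      X 0 ^ (m 0 + m 1 + m 2) * monomial (Finsupp.single 1 (m 1) + Finsupp.single 2 (m 2)) a := by
  rw [QuinticEdgeData.chartX, MvPolynomial.aeval_monomial, Finsupp.prod_pow, Fin.prod_univ_three, MvPolynomial.monomial_eq,
    Finsupp.prod_pow, Fin.prod_univ_three]
  simp only [Matrix.cons_val_zero, Matrix.cons_val_one, Matrix.cons_val_two, Matrix.tail_cons, Matrix.head_cons,
    MvPolynomial.algebraMap_eq]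
  simp
  ring

/-- **The `x`-chart identity.** For `F` homogeneous of degree `q`: `F(x, xy′, xz′) = x^q · F(1, y′, z′)` — the controlled transform
(exponent `q`, Def. 2.1 p.5) of `F` in the `x`-chart of the blow-up of the origin is its dehomogenisation `F(1, y′, z′)`, which is also
its restriction to the exceptional divisor `{x = 0}`. [OURS · L1 W3.1] kill-test helper; NOT a statement of the manuscript. -/
theorem chartX_eq_X_pow_mul_dehom {F : MvPolynomial (Fin 3) K} {q : ℕ} (hF : F.IsHomogeneous q) :
    QuinticEdgeData.chartX F = X 0 ^ q * aeval ![(1 : MvPolynomial (Fin 3) K), X 1, X 2] F := by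
  conv_lhs => rw [F.as_sum]
  conv_rhs => rw [F.as_sum]
  rw [map_sum, map_sum, Finset.mul_sum]
  refine Finset.sum_congr rfl fun m hm => ?_
  rw [chartX_monomial, dehom_monomial, sum_eq_of_mem_support hF hm]

/-- **Coefficients of the dehomogenisation.** For `F` homogeneous of degree `q`, the coefficient of `y^{m₁} z^{m₂}` in `F(1, y, z)`
is the coefficient of `x^{m₀} y^{m₁} z^{m₂}` in `F` (`m₀ = q − m₁ − m₂`): distinct monomials of `F` stay distinct.
[OURS · L1 W3.1] kill-test helper; NOT a statement of the manuscript. -/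
theorem coeff_dehom_of_isHomogeneous {F : MvPolynomial (Fin 3) K} {q : ℕ} (hF : F.IsHomogeneous q)
    {m : Fin 3 →₀ ℕ} (hm : m ∈ F.support) :
    coeff (Finsupp.single 1 (m 1) + Finsupp.single 2 (m 2)) (aeval ![(1 : MvPolynomial (Fin 3) K), X 1, X 2] F) =
      coeff m F := by
  classical
  conv_lhs => rw [F.as_sum]
  rw [map_sum, MvPolynomial.coeff_sum]
  simp_rw [dehom_monomial, MvPolynomial.coeff_monomial]
  rw [Finset.sum_eq_single m]
  · rw [if_pos rfl]
  · intro m' hm' hne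
    rw [if_neg]
    intro heq
    apply hne
    have h1 : m' 1 = m 1 := by simpa [Finsupp.single_apply] using congrArg (fun f : Fin 3 →₀ ℕ => f 1) heq
    have h2 : m' 2 = m 2 := by simpa [Finsupp.single_apply] using congrArg (fun f : Fin 3 →₀ ℕ => f 2) heq
    exact eq_of_tail_eq h1 h2 ((sum_eq_of_mem_support hF hm').trans (sum_eq_of_mem_support hF hm).symm)
  · exact fun hnot => absurd hm hnot

/-! ## §4 (E6) The escape lemma, general form: `F(1, y′, z′) ∈ (y′^q)` ⇒ `F = c·y^q` -/

/-- Membership in the monomial ideal `(y^q)`: every monomial has `y`-exponent `≥ q`. [OURS · L1 W3.1] kill-test helper;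
NOT a statement of the manuscript. -/
theorem le_of_mem_span_X_pow {D : MvPolynomial (Fin 3) K} {q : ℕ}
    (hD : D ∈ Ideal.span {(X 1 : MvPolynomial (Fin 3) K) ^ q}) :
    ∀ n ∈ D.support, q ≤ n 1 := by
  intro n hn
  have hD' : D ∈ Ideal.span ((fun s => monomial s (1 : K)) '' {Finsupp.single (1 : Fin 3) q}) := by
    rwa [Set.image_singleton, ← MvPolynomial.X_pow_eq_monomial]
  obtain ⟨s, hs, hsn⟩ := MvPolynomial.mem_ideal_span_monomial_image.mp hD' n hn
  rw [Set.mem_singleton_iff] at hs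
  subst hs
  exact Finsupp.single_le_iff.mp hsn

/-- An exponent vector of degree `q` with `y`-exponent `≥ q` is `(0, q, 0)`. [OURS · L1 W3.1] kill-test helper; NOT a statement
of the manuscript. -/
theorem eq_single_of_le {m : Fin 3 →₀ ℕ} {q : ℕ} (hdeg : m 0 + m 1 + m 2 = q) (hq : q ≤ m 1) :
    m = Finsupp.single 1 q := by
  ext i; fin_cases i
  · show m 0 = Finsupp.single (1 : Fin 3) q 0; rw [Finsupp.single_eq_of_ne (by decide)]; omega
  · show m 1 = Finsupp.single (1 : Fin 3) q 1; rw [Finsupp.single_eq_same]; omega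
  · show m 2 = Finsupp.single (1 : Fin 3) q 2; rw [Finsupp.single_eq_of_ne (by decide)]; omega

/-- A polynomial all of whose monomials are `y^q` is `c · y^q`, `c` its `y^q`-coefficient. [OURS · L1 W3.1] kill-test helper; NOT a
statement of the manuscript. -/
theorem eq_C_mul_X_pow_of_support {F : MvPolynomial (Fin 3) K} {q : ℕ}
    (hsupp : ∀ m ∈ F.support, m = Finsupp.single 1 q) : F = C (coeff (Finsupp.single 1 q) F) * X 1 ^ q := by
  classical
  ext n
  rw [MvPolynomial.coeff_C_mul, MvPolynomial.coeff_X_pow]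
  by_cases hn : Finsupp.single 1 q = n
  · subst hn; rw [if_pos rfl, mul_one]
  · rw [if_neg hn, mul_zero]
    by_contra hne
    exact hn (hsupp n (MvPolynomial.mem_support_iff.mpr hne)).symm

/-- **(E6) THE ESCAPE LEMMA, general form.** Let `F ∈ K[x, y, z]` be homogeneous of degree `q` (an initial form at the origin `O`)
and suppose its `x`-chart dehomogenisation `F(1, y′, z′)` lies in the ideal `(y′^q)`. Then `F = c · y^q` with `c` the
`y^q`-coefficient of `F`. Report §3.2 step 6: for `(h, q) ∈ ℘(Ê, q)_O` with `in_O h = F`, permissibility of the exceptional line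
`L = {x = y′ = 0}` (every point of which is a point of order `2` of the transform `f₁X`, `QuinticEdgeData.f₁X_mem_sq`) for the
transform `(x^{-q} h(x, xy′, xz′), q)` forces `x^{-q} h(x, xy′, xz′) ∈ (x, y′)^q` near `L`, whose restriction to `{x = 0}` is
`F(1, y′, z′) ∈ (y′^q)` (`chartX_eq_X_pow_mul_dehom`); so NO initial form outside `K·ȳ^q` occurs in degree `q`: `G(O) ⊆ K[ȳ]`.
Supersedes the candidate-family form `(αx̄ + γz̄)^q + βȳ^q` of p463820 §4; valid over every commutative ring `K` and for every `q`.
[OURS · L1 W3.1] kill-test helper; NOT a statement of the manuscript. -/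
theorem eq_C_mul_X_pow_of_dehom_mem_span {F : MvPolynomial (Fin 3) K} {q : ℕ} (hF : F.IsHomogeneous q)
    (hD : aeval ![(1 : MvPolynomial (Fin 3) K), X 1, X 2] F ∈ Ideal.span {(X 1 : MvPolynomial (Fin 3) K) ^ q}) :
    F = C (coeff (Finsupp.single 1 q) F) * X 1 ^ q := by
  classical
  -- every monomial of `F` is `y^q`
  have hsupp : ∀ m ∈ F.support, m = Finsupp.single 1 q := by
    intro m hm
    have hmem : Finsupp.single 1 (m 1) + Finsupp.single 2 (m 2) ∈
        (aeval ![(1 : MvPolynomial (Fin 3) K), X 1, X 2] F).support := by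
      rw [MvPolynomial.mem_support_iff, coeff_dehom_of_isHomogeneous hF hm]
      exact MvPolynomial.mem_support_iff.mp hm
    have hq : q ≤ m 1 := by
      have := le_of_mem_span_X_pow hD _ hmem
      simpa [Finsupp.single_apply] using this
    exact eq_single_of_le (sum_eq_of_mem_support hF hm) hq
  exact eq_C_mul_X_pow_of_support hsupp

/-- **(E6, edge-algebra form.)** Under the hypotheses of `eq_C_mul_X_pow_of_dehom_mem_span` the initial form `F` lies in
`K[ȳ] = Algebra.adjoin K {y}`, the carrier of the origin's edge algebra in `QuinticEdgeAlgebras.toEdgeInv_adjoin_origin`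
(typed value `invOfExponents 3 [1] = (3, 2, 1)`). [OURS · L1 W3.1] kill-test helper; NOT a statement of the manuscript. -/
theorem mem_adjoin_origin_of_dehom_mem_span {F : MvPolynomial (Fin 3) K} {q : ℕ} (hF : F.IsHomogeneous q)
    (hD : aeval ![(1 : MvPolynomial (Fin 3) K), X 1, X 2] F ∈ Ideal.span {(X 1 : MvPolynomial (Fin 3) K) ^ q}) :
    F ∈ Algebra.adjoin K ({X 1} : Set (MvPolynomial (Fin 3) K)) := by
  rw [eq_C_mul_X_pow_of_dehom_mem_span hF hD]
  exact Subalgebra.mul_mem _ (Subalgebra.algebraMap_mem _ _)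
    (Subalgebra.pow_mem _ (Algebra.subset_adjoin (Set.mem_singleton _)) _)

/-- **(E6, converse / sharpness.)** `y^q` itself passes the test: `(y^q)(1, y′, z′) = y′^q ∈ (y′^q)` — the escape lemma cuts
`G(O)_q` down to exactly the line `K·ȳ^q`, not further (and `ȳ ∈ G(O)₁` by `QuinticEdgeData.pderiv_f_one`, report step 4).
[OURS · L1 W3.1] kill-test helper; NOT a statement of the manuscript. -/
theorem dehom_X_pow_mem_span (q : ℕ) :
    aeval ![(1 : MvPolynomial (Fin 3) K), X 1, X 2] ((X 1 : MvPolynomial (Fin 3) K) ^ q) ∈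
      Ideal.span {(X 1 : MvPolynomial (Fin 3) K) ^ q} := by
  rw [map_pow, MvPolynomial.aeval_X]
  exact Ideal.subset_span (by simp)

/-! ## §5 (E6′) The escape lemma, pointwise form: two exceptional points suffice

The pre-registered / CAS-checked variant of step 6 (kit job j258736 row `f_escape_test_at_O`, `q ≤ 4`, symbolic point `(0, 0, a)`):
permissibility of the closed POINTS `(0, 0, a)` of the exceptional line for the transform `(x^{-q} h(x, xy′, xz′), q)` gives, after
restriction to `{x = 0}`, `ord_{(0, a)} F(1, y′, z′) ≥ q` for every `a`. Below: the two points `a = 0` and `a = 1` already force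
`F = c · y^q`, over every commutative ring and for every `q` (the order condition at `(0, 0, a)` is phrased through the translation
`QuinticEdgeData.shiftQ a`, `z′ ↦ z′ + a`: every monomial of the translated polynomial has degree `≥ q`). -/

/-- Order `≥ q` at `(0, 0, 0)` of `F(1, y′, z′)` forces: no monomial of the degree-`q` form `F` involves `x`, i.e. `F ∈ K[y, z]_q`.
[OURS · L1 W3.1] kill-test helper; NOT a statement of the manuscript. -/
theorem apply_zero_eq_zero_of_order {F : MvPolynomial (Fin 3) K} {q : ℕ} (hF : F.IsHomogeneous q)
    (h0 : ∀ n ∈ (aeval ![(1 : MvPolynomial (Fin 3) K), X 1, X 2] F).support, q ≤ n.degree)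
    {m : Fin 3 →₀ ℕ} (hm : m ∈ F.support) : m 0 = 0 ∧ m 1 + m 2 = q := by
  classical
  have hmem : Finsupp.single 1 (m 1) + Finsupp.single 2 (m 2) ∈
      (aeval ![(1 : MvPolynomial (Fin 3) K), X 1, X 2] F).support := by
    rw [MvPolynomial.mem_support_iff, coeff_dehom_of_isHomogeneous hF hm]
    exact MvPolynomial.mem_support_iff.mp hm
  have hq := h0 _ hmem
  rw [Finsupp.degree_eq_sum, Fin.sum_univ_three] at hq
  simp only [Finsupp.coe_add, Pi.add_apply, Finsupp.single_apply, Fin.isValue, one_ne_zero, ↓reduceIte, Fin.reduceEq,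
    add_zero, zero_add] at hq
  have hdeg := sum_eq_of_mem_support hF hm
  omega

/-- A polynomial without `x` is its own dehomogenisation: `F(1, y, z) = F`. [OURS · L1 W3.1] kill-test helper; NOT a statement of the
manuscript. -/
theorem dehom_eq_self {F : MvPolynomial (Fin 3) K} (hx : ∀ m ∈ F.support, m 0 = 0) :
    aeval ![(1 : MvPolynomial (Fin 3) K), X 1, X 2] F = F := by
  conv_lhs => rw [F.as_sum]
  conv_rhs => rw [F.as_sum]
  rw [map_sum]
  refine Finset.sum_congr rfl fun m hm => ?_
  have hs : Finsupp.single 1 (m 1) + Finsupp.single 2 (m 2) = m := by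
    ext i; fin_cases i
    · simpa [Finsupp.single_apply] using (hx m hm).symm
    all_goals simp
  rw [dehom_monomial, hs]

/-- Killing `z′` after translating by `c` is evaluating `z′ ↦ c`: `(G(x, y′, z′ + c))|_{z′ = 0} = G(x, y′, c)`.
[OURS · L1 W3.1] kill-test helper; NOT a statement of the manuscript. -/
theorem killZ_shiftQ (c : K) (G : MvPolynomial (Fin 3) K) :
    aeval ![(X 0 : MvPolynomial (Fin 3) K), X 1, 0] (QuinticEdgeData.shiftQ c G) =
      aeval ![(X 0 : MvPolynomial (Fin 3) K), X 1, C c] G := by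
  rw [QuinticEdgeData.shiftQ, ← AlgHom.comp_apply]
  congr 1
  exact MvPolynomial.algHom_ext fun i => by fin_cases i <;> simp

/-- Killing `z` does not change the coefficients of `z`-free monomials. [OURS · L1 W3.1] kill-test helper; NOT a statement of the
manuscript. -/
theorem coeff_killZ (G : MvPolynomial (Fin 3) K) {n : Fin 3 →₀ ℕ} (hn : n 2 = 0) :
    coeff n (aeval ![(X 0 : MvPolynomial (Fin 3) K), X 1, 0] G) = coeff n G := by
  classical
  conv_lhs => rw [G.as_sum]
  rw [map_sum, MvPolynomial.coeff_sum]
  have hmon : ∀ m : Fin 3 →₀ ℕ, ∀ a : K, coeff n (aeval ![(X 0 : MvPolynomial (Fin 3) K), X 1, 0] (monomial m a)) =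
      if m = n then a else 0 := by
    intro m a
    rw [MvPolynomial.aeval_monomial, Finsupp.prod_pow, Fin.prod_univ_three]
    simp only [Matrix.cons_val_zero, Matrix.cons_val_one, Matrix.cons_val_two, Matrix.tail_cons, Matrix.head_cons,
      MvPolynomial.algebraMap_eq]
    by_cases hm2 : m 2 = 0
    · rw [hm2, pow_zero, mul_one]
      have hmon' : (C a * (X 0 ^ m 0 * X 1 ^ m 1) : MvPolynomial (Fin 3) K) = monomial m a := by
        rw [MvPolynomial.monomial_eq, Finsupp.prod_pow, Fin.prod_univ_three, hm2, pow_zero, mul_one]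
      rw [hmon', MvPolynomial.coeff_monomial]
    · have hne : m ≠ n := fun h => hm2 (h ▸ hn)
      rw [zero_pow hm2, mul_zero, mul_zero, MvPolynomial.coeff_zero, if_neg hne]
  simp_rw [hmon]
  rw [Finset.sum_ite_eq' G.support n]
  split_ifs with h
  exacts [rfl, (MvPolynomial.notMem_support_iff.mp h).symm]

/-- Evaluating `z ↦ c` on a monomial. [OURS · L1 W3.1] kill-test helper; NOT a statement of the manuscript. -/
theorem evalZ_monomial (c : K) (m : Fin 3 →₀ ℕ) (a : K) :
    aeval ![(X 0 : MvPolynomial (Fin 3) K), X 1, C c] (monomial m a) =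
      monomial (Finsupp.single 0 (m 0) + Finsupp.single 1 (m 1)) (a * c ^ (m 2)) := by
  rw [MvPolynomial.aeval_monomial, Finsupp.prod_pow, Fin.prod_univ_three, MvPolynomial.monomial_eq, Finsupp.prod_pow,
    Fin.prod_univ_three]
  simp only [Matrix.cons_val_zero, Matrix.cons_val_one, Matrix.cons_val_two, Matrix.tail_cons, Matrix.head_cons,
    MvPolynomial.algebraMap_eq, map_mul, map_pow]
  simp
  ring

/-- For a degree-`q` form `F ∈ K[y, z]` the `y′^{m₁}`-coefficient of `F(y′, z′ + 1)` restricted to `z′ = 0` — equivalently of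
`F(y, 1)` — is the `y^{m₁} z^{q − m₁}`-coefficient of `F`. [OURS · L1 W3.1] kill-test helper; NOT a statement of the manuscript. -/
theorem coeff_evalZ_one {F : MvPolynomial (Fin 3) K} {q : ℕ} (hF0 : ∀ m ∈ F.support, m 0 = 0 ∧ m 1 + m 2 = q)
    {m : Fin 3 →₀ ℕ} (hm : m ∈ F.support) :
    coeff (Finsupp.single 1 (m 1)) (aeval ![(X 0 : MvPolynomial (Fin 3) K), X 1, C 1] F) = coeff m F := by
  classical
  conv_lhs => rw [F.as_sum]
  rw [map_sum, MvPolynomial.coeff_sum]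
  simp_rw [evalZ_monomial, one_pow, mul_one, MvPolynomial.coeff_monomial]
  rw [Finset.sum_eq_single m]
  · rw [if_pos]
    rw [(hF0 m hm).1, Finsupp.single_zero, zero_add]
  · intro m' hm' hne
    rw [if_neg]
    intro heq
    apply hne
    obtain ⟨h0', hs'⟩ := hF0 m' hm'
    obtain ⟨h0, hs⟩ := hF0 m hm
    have h1 : m' 1 = m 1 := by simpa [Finsupp.single_apply] using congrArg (fun f : Fin 3 →₀ ℕ => f 1) heq
    exact eq_of_tail_eq h1 (by omega) (by omega)
  · exact fun hnot => absurd hm hnot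

/-- **(E6′) THE ESCAPE LEMMA, pointwise form: two exceptional points suffice.** Let `F` be homogeneous of degree `q` and
`D = F(1, y′, z′)` its `x`-chart dehomogenisation. If `D` has order `≥ q` at `(y′, z′) = (0, 0)` AND at `(y′, z′) = (0, 1)` (every
monomial of `D`, resp. of `D(y′, z′ + 1) = QuinticEdgeData.shiftQ 1 D`, has degree `≥ q`) — the conditions that permissibility of the
two closed points `(0, 0, 0)`, `(0, 0, 1)` of the exceptional line imposes — then `F = c · y^q`. Over every commutative ring, every `q`;
supersedes the CAS row `f_escape_test_at_O` of kit job j258736 (`q ≤ 4`, symbolic point). [OURS · L1 W3.1] kill-test helper; NOT a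
statement of the manuscript. -/
theorem eq_C_mul_X_pow_of_order_at_two_points {F : MvPolynomial (Fin 3) K} {q : ℕ} (hF : F.IsHomogeneous q)
    (h0 : ∀ n ∈ (aeval ![(1 : MvPolynomial (Fin 3) K), X 1, X 2] F).support, q ≤ n.degree)
    (h1 : ∀ n ∈ (QuinticEdgeData.shiftQ 1 (aeval ![(1 : MvPolynomial (Fin 3) K), X 1, X 2] F)).support, q ≤ n.degree) :
    F = C (coeff (Finsupp.single 1 q) F) * X 1 ^ q := by
  classical
  have hF0 : ∀ m ∈ F.support, m 0 = 0 ∧ m 1 + m 2 = q := fun m hm => apply_zero_eq_zero_of_order hF h0 hm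
  have hDF : aeval ![(1 : MvPolynomial (Fin 3) K), X 1, X 2] F = F := dehom_eq_self fun m hm => (hF0 m hm).1
  rw [hDF] at h1
  refine eq_C_mul_X_pow_of_support fun m hm => ?_
  have hcoeff : coeff (Finsupp.single 1 (m 1)) (QuinticEdgeData.shiftQ 1 F) = coeff m F := by
    rw [← coeff_killZ (QuinticEdgeData.shiftQ 1 F) (by simp), killZ_shiftQ, coeff_evalZ_one hF0 hm]
  have hmem : Finsupp.single 1 (m 1) ∈ (QuinticEdgeData.shiftQ 1 F).support := by
    rw [MvPolynomial.mem_support_iff, hcoeff]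
    exact MvPolynomial.mem_support_iff.mp hm
  have hq : q ≤ m 1 := by simpa using h1 _ hmem
  exact eq_single_of_le (sum_eq_of_mem_support hF hm) hq

end Summit.ResolutionOfSingularities.ResolutionOfSingularities.Theorems.QuinticEscapeLemma

end
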